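import Summits.QuantumFields.YangMills.Theorems.BalabanUVNodesN15KingModelComplexCoercive
import Summits.QuantumFields.YangMills.Theorems.BalabanUVNodesN15KingModelPotentialEnvelope
import Summits.QuantumFields.BalabanUV.T4Continuum.Support.UnitaryCayley
import Mathlib.Analysis.Complex.Liouville

/-!
# N15 (NE2) King-model rung, PART 28b — KING'S EFFECTIVE LAPLACIAN AND THE DRESSED COVARIANCES AT COMPLEX COUPLING:
# HOLOMORPHY, k-UNIFORM BOUNDS, CAUCHY ESTIMATES ([B9] Theorem 3.4 in King's A = 0 model)

Tenth generation (g10) of the seat `pub-ymgap-dag-n15-d`, part 28b (on part 28a `…ComplexCoercive` and part 8d `…PotentialEnvelope`).  Part 8d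
dresses King's fine-lattice operator by a REAL potential, `A₀(w) = A₀ + diag w`, and King's effective Laplacian `Δ_eff(w) = a·1 −
a²N^{d+1}·Q A₀(w)⁻¹ Qᵀ`; parts 9e∕9f differentiate the dressed objects along REAL rays `t ↦ t·w`.  Here the coupling is COMPLEX:

* §1 `fineOpPotC z w = A₀ + z·diag w` and `effLaplacianPotC z w = a·1 − a²N^{d+1}·Q (A₀ + z·diag w)⁻¹ Qᵀ` over ℂ; at a real coupling they are
  the real objects of 8d read over ℂ (`fineOpPotC_ofReal`, `effLaplacianPotC_ofReal`); `A₀ + z·diag w` is `Re`-COERCIVE (shape `γ·nsq x ≤ Re⟨x̄, Sx⟩` of 28a) with constant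
  `m² − ‖z‖·sup|w|` (`reCoercive_fineOpPotC`), hence invertible and every entry of `Δ_eff(z·w)` is HOLOMORPHIC in `z` on `‖z‖·sup|w| < m²`
  (`differentiableAt_effLaplacianPotC_apply`);
* §2 THE FORM BOUND: `‖⟨x̄, (Δ_eff(z·w) − Δ_eff(0))x⟩‖ ≤ (2a²∕m⁴)·‖z‖·sup|w|·‖x‖₂²` on `‖z‖·sup|w| ≤ m²∕2` (second resolvent identity, the
  resolvent bound of 28a twice, `‖Qᵀx‖₂² = N^{−(d+1)}‖x‖₂²`) — (3.64)–(3.65) of [B9] in this model;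
* §3 KING'S LEVELS: `kingLevelPotC k z w = Δ^{(k)}_{z·w}`, the dressed covariance `kingCovPotC k z w = (Δ^{(k)}_{z·w} + aL⁻²Q*Q)⁻¹`; on the disc
  `‖z‖·sup|w| ≤ r_K := min(m²∕2, γ₀m⁴∕(4a²))` (`cplxWindow`, uniform in `k`, the volume and the potential) the matrix `Δ^{(k)}_{z·w} + aL⁻²Q*Q` is
  `Re`-coercive with constant `γ₀∕2` (`reCoercive_kingLevelPotC_add_block_window`; `γ₀ = gam0L` of King's (4.33)), so
  ★★ `kingCovPotC_apply_norm_le`: `‖C^{(k)}_z(x,y)‖ ≤ 2∕γ₀` for all `k ≥ 1`, volumes, sites and `z` in the disc;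
  ★★ `differentiableAt_kingCovPotC_apply`: `z ↦ C^{(k)}_z(x,y)` is HOLOMORPHIC on the disc; `kingCovPotC_ofReal`: at real coupling it is 9c's
  dressed covariance `(Δ^{(k)}_{t·w} + aL⁻²Q*Q)⁻¹` read over ℂ;
  ★★ `norm_iteratedDeriv_kingCovPotC_le` — CAUCHY'S ESTIMATE, ALL ORDERS, UNIFORM IN THE CUTOFF: for every centre `z₀` and radius `R` with
  `(‖z₀‖ + R)·sup|w| ≤ r_K`, `‖∂ⁿ_z C^{(k)}_z(x,y)|_{z₀}‖ ≤ n!·(2∕γ₀)∕Rⁿ` — the `n`-th order of φ²-source perturbation theory of the block-spin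
  covariance at level `k` is bounded by `(2∕γ₀)·R^{−n}` uniformly in `k` and the volume.

PRINTED ANCHOR (template). [B9] = T. Bałaban, Commun. Math. Phys. **99** (1985) 389–434, Theorem 3.4 p. 400 («the operators … extend … as analytic
functions of A. The extended operators satisfy all the inequalities of Theorems 3.1–3.3»), (3.64)–(3.65) p. 402.  Model: C. King, Commun. Math. Phys.
**102** (1986) 649–677 [King1986]: (2.13)–(2.14) p. 653, (4.5) p. 670, (4.32)–(4.33) p. 674 (`C^{(k)} = (Δ^{(k)} + aL⁻²Q*Q)⁻¹ ≥ γ₀`, A = 0).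

HONEST SCOPE.  King's A = 0 SCALAR block-spin tower on an arbitrary unit torus `Π ℤ∕(LM_μ)` (`L ≥ 2`, `a, m² > 0`, levels `k ≥ 1`); the
potential `w` is a REAL function on the fine torus and only the coupling `z` is complex — `z·w` is a complex MASS insertion, NOT a gauge field
and NOT Bałaban's complexified configuration `U′U = e^{iηA}U`; the bounds are operator∕entry bounds with NO decay off the real axis (the real-axis
decay is parts 9a∕9c); nothing is claimed for Bałaban's `G(U)`, `Δ^{(k)}(U)`, `C^{(k)}(Λ; U)`; NOT a node discharge; count-neutral.
No `sorry`, standard axioms, default heartbeats.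
-/

noncomputable section

open scoped BigOperators Matrix ComplexConjugate
open Finset

namespace Summit.QuantumFields.YangMills.BalabanUVNodes.N15.KingModel

open Literature.MathematicalPhysics.QuantumFieldTheory.Balaban1983to89 hiding blockOf
open Literature.MathematicalPhysics.QuantumFieldTheory.Balaban1983to89.QGQInverse (Coercive)
open Literature.MathematicalPhysics.QuantumFieldTheory.Balaban1983to89.B5Prop11Plancherel (Tor fine)
open Literature.MathematicalPhysics.QuantumFieldTheory.King1986 (aK aK_pos aK_le)
open Literature.MathematicalPhysics.QuantumFieldTheory.King1986.Torus (fineOp fineOp_coercive effLaplacian Qmat blockOf site blockOf_site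
  gam0L gam0L_pos)
open Literature.MathematicalPhysics.QuantumFieldTheory.Balaban1983to89.B5Prop11Lower (nsq nsq_nonneg)
open Summit.QuantumFields.BalabanUV.T4Continuum.NE2KingTransplant (UniformCoercive)
open Summit.QuantumFields.BalabanUV.T4Continuum.UnitaryCayley (inv_sub_inv_eq)

variable {d : ℕ}

/-! ## §1 King's fine operator and effective Laplacian at COMPLEX coupling -/

section Fine

variable (N : ℕ) [NeZero N] (U : Fin (d + 1) → ℕ) [∀ μ, NeZero (U μ)] (a c m2 : ℝ)

/-- **KING'S FINE-LATTICE OPERATOR AT COMPLEX COUPLING** `A₀ + z·diag w` (8d's `fineOpPot (t·w)` with the real `t` replaced by `z ∈ ℂ`).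
[cite: King1986, (2.13)–(2.14) p.653, (4.5) p.670 (A₀, A = 0); Balaban1985BackgroundPropagators, Thm 3.4 p.400 (the complexification device)] -/
def fineOpPotC (z : ℂ) (w : Tor (fine N U) → ℝ) : Matrix (Tor (fine N U)) (Tor (fine N U)) ℂ :=
  (fineOp N U a c m2).map Complex.ofReal + z • Matrix.diagonal (fun x => (w x : ℂ))

/-- **KING'S EFFECTIVE LAPLACIAN AT COMPLEX COUPLING** `Δ_eff(z·w) = a·1 − a²N^{d+1}·Q (A₀ + z·diag w)⁻¹ Qᵀ` over ℂ (8d's `effLaplacianPot (t·w)`, `t ↦ z`).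
TOTALITY NOTE: outside the invertibility disc the inverse is `Matrix.inv`'s junk value `0`; every theorem below works inside `‖z‖·sup|w| < m²`.
[cite: King1986, (2.13)–(2.14) p.653, (4.5) p.670 (A = 0)] -/
def effLaplacianPotC (z : ℂ) (w : Tor (fine N U) → ℝ) : Matrix (Tor U) (Tor U) ℂ :=
  (a : ℂ) • (1 : Matrix (Tor U) (Tor U) ℂ)
    - ((a ^ 2 * (N : ℝ) ^ (d + 1) : ℝ) : ℂ)
        • ((Qmat N U).map Complex.ofReal * (fineOpPotC N U a c m2 z w)⁻¹ * ((Qmat N U).map Complex.ofReal)ᵀ)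

variable {N U a c m2}

omit [NeZero N] [∀ μ, NeZero (U μ)] in
/-- The real diagonal read over ℂ. [folklore] -/
theorem diagonal_map_ofReal (w : Tor (fine N U) → ℝ) :
    (Matrix.diagonal w).map Complex.ofReal = Matrix.diagonal (fun x => (w x : ℂ)) :=
  Matrix.diagonal_map Complex.ofReal_zero

/-- **At a real coupling the complex fine operator is 8d's, read over ℂ**: `A₀ + (t : ℂ)·diag w = (A₀(t·w)).map ofReal`. [folklore] -/
theorem fineOpPotC_ofReal (t : ℝ) (w : Tor (fine N U) → ℝ) :
    fineOpPotC N U a c m2 (t : ℂ) w = (fineOpPot N U a c m2 (t • w)).map Complex.ofReal := by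
  rw [fineOpPot_smul, ← affine_map_ofReal, diagonal_map_ofReal]
  rfl

/-- **At a real coupling the complex effective Laplacian is 8d's, read over ℂ**: `Δ_eff((t : ℂ)·w) = (Δ_eff(t·w)).map ofReal`. [folklore] -/
theorem effLaplacianPotC_ofReal (t : ℝ) (w : Tor (fine N U) → ℝ) :
    effLaplacianPotC N U a c m2 (t : ℂ) w = (effLaplacianPot N U a c m2 (t • w)).map Complex.ofReal := by
  rw [effLaplacianPotC, effLaplacianPot, fineOpPotC_ofReal, map_ofReal_inv, map_ofReal_sub, map_ofReal_smul, map_ofReal_smul,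
    map_ofReal_mul, map_ofReal_mul, ← Matrix.transpose_map, Matrix.map_one Complex.ofReal Complex.ofReal_zero Complex.ofReal_one]

/-- At coupling `0` the complex effective Laplacian is King's `Δ_eff`, read over ℂ. [folklore] -/
theorem effLaplacianPotC_zero (w : Tor (fine N U) → ℝ) :
    effLaplacianPotC N U a c m2 0 w = (effLaplacian N U a c m2).map Complex.ofReal := by
  have h := effLaplacianPotC_ofReal (N := N) (U := U) (a := a) (c := c) (m2 := m2) 0 w
  rw [Complex.ofReal_zero, zero_smul] at h
  have h0 : effLaplacianPot N U a c m2 (0 : Tor (fine N U) → ℝ) = effLaplacian N U a c m2 := effLaplacianPot_zero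
  rw [h, h0]

/-- **`A₀ + z·diag w` IS `Re`-COERCIVE with constant `m² − ‖z‖·sup|w|`** (King's `A₀ ≥ m²` over ℂ, minus the diagonal's form bound). [cite: King1986, (4.5) p.670 (A = 0)] -/
theorem reCoercive_fineOpPotC (ha : 0 ≤ a) (hc : 0 ≤ c) {w : Tor (fine N U) → ℝ} {w₀ : ℝ} (hw : ∀ x, |w x| ≤ w₀) (z : ℂ)
    (x : Tor (fine N U) → ℂ) : (m2 - ‖z‖ * w₀) * nsq x ≤ (star x ⬝ᵥ fineOpPotC N U a c m2 z w *ᵥ x).re :=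
  reCoercive_add_of_norm_form_le (reCoercive_map_ofReal (fineOp_coercive N U m2 ha hc)) (norm_form_smul_diagonal_le hw z) x

/-- Inside the disc `‖z‖·sup|w| < m²` the complex fine operator has invertible determinant. [folklore] -/
theorem isUnit_det_fineOpPotC (ha : 0 ≤ a) (hc : 0 ≤ c) {w : Tor (fine N U) → ℝ} {w₀ : ℝ} (hw : ∀ x, |w x| ≤ w₀) {z : ℂ}
    (hz : ‖z‖ * w₀ < m2) : IsUnit (fineOpPotC N U a c m2 z w).det :=
  isUnit_det_of_reCoercive (by linarith) (reCoercive_fineOpPotC ha hc hw z)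

/-- **Every entry of `(A₀ + z·diag w)⁻¹` is holomorphic in `z`** on `‖z‖·sup|w| < m²`. [cite: Balaban1985BackgroundPropagators, Thm 3.4 p.400, (3.64) p.402 (template)] -/
theorem differentiableAt_fineOpPotC_inv_apply (ha : 0 ≤ a) (hc : 0 ≤ c) {w : Tor (fine N U) → ℝ} {w₀ : ℝ} (hw : ∀ x, |w x| ≤ w₀) {z : ℂ}
    (hz : ‖z‖ * w₀ < m2) (x y : Tor (fine N U)) :
    DifferentiableAt ℂ (fun z => (fineOpPotC N U a c m2 z w)⁻¹ x y) z :=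
  differentiableAt_inv_apply_of_entries (M := fun z => fineOpPotC N U a c m2 z w)
    (fun i j => differentiableAt_affine_entry _ _ z i j) (isUnit_det_fineOpPotC ha hc hw hz) x y

/-- **EVERY ENTRY OF KING'S EFFECTIVE LAPLACIAN IS HOLOMORPHIC IN THE COMPLEX COUPLING** on `‖z‖·sup|w| < m²` (finite sums and products of the
holomorphic inverse entries). [cite: Balaban1985BackgroundPropagators, Thm 3.4 p.400 (template); King1986, (2.14) p.653] -/
theorem differentiableAt_effLaplacianPotC_apply (ha : 0 ≤ a) (hc : 0 ≤ c) {w : Tor (fine N U) → ℝ} {w₀ : ℝ} (hw : ∀ x, |w x| ≤ w₀)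
    {z : ℂ} (hz : ‖z‖ * w₀ < m2) (b b' : Tor U) :
    DifferentiableAt ℂ (fun z => effLaplacianPotC N U a c m2 z w b b') z := by
  have hF := differentiableAt_fineOpPotC_inv_apply (N := N) (U := U) (a := a) (c := c) (m2 := m2) ha hc hw hz
  unfold effLaplacianPotC
  simp only [Matrix.sub_apply, Matrix.smul_apply, Matrix.mul_apply, Matrix.map_apply, Matrix.transpose_apply, smul_eq_mul]
  refine (differentiableAt_const _).sub ((differentiableAt_const _).mul ?_)
  refine DifferentiableAt.fun_sum fun y _ => ?_
  refine (DifferentiableAt.fun_sum fun x _ => ?_).mul (differentiableAt_const _)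
  exact (differentiableAt_const _).mul (hF x y)

/-! ## §2 The form bound of `Δ_eff(z·w) − Δ_eff(0)` (second resolvent identity) -/

/-- `(Qᵀx)(z) = N^{−(d+1)}·x(block of z)` over ℂ. [cite: King1986, (2.4) p.652, (2.10)–(2.11) p.653] -/
theorem transpose_QmatC_mulVec (x : Tor U → ℂ) (z : Tor (fine N U)) :
    (((Qmat N U).map Complex.ofReal)ᵀ *ᵥ x) z = ((((N : ℝ) ^ (d + 1))⁻¹ : ℝ) : ℂ) * x (blockOf N U z) := by
  simp only [Matrix.mulVec, dotProduct, Matrix.transpose_apply, Matrix.map_apply, Qmat]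
  simp_rw [apply_ite Complex.ofReal, Complex.ofReal_zero, ite_mul, zero_mul]
  rw [Finset.sum_ite_eq]
  simp

/-- `Qᵀ` commutes with complex conjugation (real entries). [folklore] -/
theorem star_transpose_QmatC_mulVec (x : Tor U → ℂ) :
    star (((Qmat N U).map Complex.ofReal)ᵀ *ᵥ x) = ((Qmat N U).map Complex.ofReal)ᵀ *ᵥ star x := by
  funext z
  rw [Pi.star_apply, transpose_QmatC_mulVec, transpose_QmatC_mulVec, Pi.star_apply, star_mul', Complex.star_def, Complex.conj_ofReal]

/-- **`‖Qᵀx‖₂² = N^{−(d+1)}‖x‖₂²`** (`N^{d+1}` fine points per block, each carrying `N^{−(d+1)}x_b`). [cite: King1986, (2.10)–(2.11) p.653] -/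
theorem nsq_transpose_QmatC_mulVec (x : Tor U → ℂ) :
    nsq (((Qmat N U).map Complex.ofReal)ᵀ *ᵥ x) = (((N : ℕ) : ℝ) ^ (d + 1))⁻¹ * nsq x := by
  have hN : (((N : ℕ) : ℝ) ^ (d + 1)) ≠ 0 := pow_ne_zero _ (Nat.cast_ne_zero.mpr (NeZero.ne N))
  have hNn : 0 ≤ (((N : ℝ) ^ (d + 1))⁻¹ : ℝ) := inv_nonneg.mpr (pow_nonneg (Nat.cast_nonneg N) (d + 1))
  have hc : ‖((((N : ℝ) ^ (d + 1))⁻¹ : ℝ) : ℂ)‖ = ((N : ℝ) ^ (d + 1))⁻¹ := Complex.norm_of_nonneg hNn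
  unfold nsq
  simp_rw [transpose_QmatC_mulVec, norm_mul, hc]
  rw [sum_fine_eq_sum_blocks N U]
  simp_rw [blockOf_site]
  simp only [sum_const, card_univ, nsmul_eq_mul]
  rw [mul_sum]
  refine sum_congr rfl fun b _ => ?_
  rw [card_offsets N]
  field_simp

/-- The complex perturbation of the effective Laplacian is a sandwich of the resolvent difference:
`Δ_eff(z·w) − Δ_eff(0) = −a²N^{d+1}·Q((A₀ + z·diag w)⁻¹ − A₀⁻¹)Qᵀ`. [folklore] -/
theorem effLaplacianPotC_sub_zero (z : ℂ) (w : Tor (fine N U) → ℝ) :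
    effLaplacianPotC N U a c m2 z w - effLaplacianPotC N U a c m2 0 w
      = -(((a ^ 2 * (N : ℝ) ^ (d + 1) : ℝ) : ℂ)
          • ((Qmat N U).map Complex.ofReal * ((fineOpPotC N U a c m2 z w)⁻¹ - (fineOpPotC N U a c m2 0 w)⁻¹)
              * ((Qmat N U).map Complex.ofReal)ᵀ)) := by
  simp only [effLaplacianPotC, Matrix.mul_sub, Matrix.sub_mul, smul_sub]
  abel

/-- The Hermitian form of a scalar multiple of a `Q M Qᵀ` sandwich: `⟨x̄, c·(Q M Qᵀ)x⟩ = c·⟨(Qᵀx)‾, M(Qᵀx)⟩`. [folklore] -/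
theorem form_smul_sandwich (cst : ℂ) (M : Matrix (Tor (fine N U)) (Tor (fine N U)) ℂ) (x : Tor U → ℂ) :
    star x ⬝ᵥ (cst • ((Qmat N U).map Complex.ofReal * M * ((Qmat N U).map Complex.ofReal)ᵀ)) *ᵥ x
      = cst * (star (((Qmat N U).map Complex.ofReal)ᵀ *ᵥ x) ⬝ᵥ M *ᵥ (((Qmat N U).map Complex.ofReal)ᵀ *ᵥ x)) := by
  rw [Matrix.smul_mulVec, dotProduct_smul, smul_eq_mul, ← Matrix.mulVec_mulVec, ← Matrix.mulVec_mulVec, Matrix.dotProduct_mulVec,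
    ← Matrix.mulVec_transpose, star_transpose_QmatC_mulVec]

/-- **THE FORM BOUND OF THE COMPLEX PERTURBATION — (3.64)–(3.65) OF [B9] IN KING'S MODEL**: for `a, c ≥ 0`, `m² > 0`, `|w| ≤ w₀` and
`‖z‖·w₀ ≤ m²∕2`, `‖⟨x̄, (Δ_eff(z·w) − Δ_eff(0))x⟩‖ ≤ (2a²∕m⁴)·(‖z‖w₀)·‖x‖₂²` (second resolvent identity
`(A₀ + zW)⁻¹ − A₀⁻¹ = −(A₀ + zW)⁻¹(zW)A₀⁻¹`, the resolvent bounds `2∕m²`, `1∕m²` of 28a, `‖zWv‖₂ ≤ ‖z‖w₀‖v‖₂`, and `a²N^{d+1}·‖Qᵀx‖₂² = a²‖x‖₂²`).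
[cite: Balaban1985BackgroundPropagators, Thm 3.4 p.400, (3.64)–(3.65) p.402 (template); King1986, (2.14) p.653, (4.5) p.670] -/
theorem norm_form_effLaplacianPotC_sub_le (ha : 0 ≤ a) (hc : 0 ≤ c) (hm : 0 < m2) {w : Tor (fine N U) → ℝ} {w₀ : ℝ} (hw₀ : 0 ≤ w₀)
    (hw : ∀ x, |w x| ≤ w₀) {z : ℂ} (hz : ‖z‖ * w₀ ≤ m2 / 2) (x : Tor U → ℂ) :
    ‖star x ⬝ᵥ (effLaplacianPotC N U a c m2 z w - effLaplacianPotC N U a c m2 0 w) *ᵥ x‖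
      ≤ (2 * a ^ 2 / m2 ^ 2 * (‖z‖ * w₀)) * nsq x := by
  set Qc := (Qmat N U).map Complex.ofReal with hQc
  set S := fineOpPotC N U a c m2 z w with hSdef
  set S0 := fineOpPotC N U a c m2 0 w with hS0def
  set W := z • Matrix.diagonal (fun i : Tor (fine N U) => (w i : ℂ)) with hW
  have hS : ∀ x, (m2 / 2) * nsq x ≤ (star x ⬝ᵥ S *ᵥ x).re := reCoercive_mono (reCoercive_fineOpPotC ha hc hw z) (by linarith)
  have hS0 : ∀ x, m2 * nsq x ≤ (star x ⬝ᵥ S0 *ᵥ x).re := by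
    have h := reCoercive_fineOpPotC (N := N) (U := U) (a := a) (c := c) (m2 := m2) ha hc hw 0
    rwa [norm_zero, zero_mul, sub_zero] at h
  have hm2 : 0 < m2 / 2 := by linarith
  have hSu : IsUnit S.det := isUnit_det_of_reCoercive hm2 hS
  have hS0u : IsUnit S0.det := isUnit_det_of_reCoercive hm hS0
  have hdiff : S0 - S = -W := by
    simp only [hSdef, hS0def, hW, fineOpPotC, zero_smul, add_zero]
    abel
  rw [effLaplacianPotC_sub_zero, Matrix.neg_mulVec, dotProduct_neg, norm_neg, form_smul_sandwich, inv_sub_inv_eq hSu hS0u, hdiff,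
    norm_mul, ← Matrix.mulVec_mulVec, ← Matrix.mulVec_mulVec]
  set y := Qcᵀ *ᵥ x with hy
  set u := (-W) *ᵥ (S0⁻¹ *ᵥ y) with hu
  have hcoeff : ‖(((a ^ 2 * (N : ℝ) ^ (d + 1) : ℝ)) : ℂ)‖ = a ^ 2 * (N : ℝ) ^ (d + 1) := Complex.norm_of_nonneg (by positivity)
  have h1 : ‖star y ⬝ᵥ S⁻¹ *ᵥ u‖ ≤ (m2 / 2)⁻¹ * (Real.sqrt (nsq y) * Real.sqrt (nsq u)) := norm_star_dotProduct_inv_mulVec_le hm2 hS y u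
  have h2 : Real.sqrt (nsq u) ≤ ‖z‖ * w₀ * (m2⁻¹ * Real.sqrt (nsq y)) := by
    rw [hu, Matrix.neg_mulVec, nsq_neg]
    exact (sqrt_nsq_smul_diagonal_mulVec_le hw₀ hw z _).trans
      (mul_le_mul_of_nonneg_left (sqrt_nsq_inv_mulVec_le hm hS0 y) (mul_nonneg (norm_nonneg z) hw₀))
  have h3 : ‖star y ⬝ᵥ S⁻¹ *ᵥ u‖ ≤ (m2 / 2)⁻¹ * (‖z‖ * w₀ * m2⁻¹) * nsq y := by
    calc ‖star y ⬝ᵥ S⁻¹ *ᵥ u‖ ≤ (m2 / 2)⁻¹ * (Real.sqrt (nsq y) * Real.sqrt (nsq u)) := h1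
      _ ≤ (m2 / 2)⁻¹ * (Real.sqrt (nsq y) * (‖z‖ * w₀ * (m2⁻¹ * Real.sqrt (nsq y)))) :=
          mul_le_mul_of_nonneg_left (mul_le_mul_of_nonneg_left h2 (Real.sqrt_nonneg _)) (inv_nonneg.mpr hm2.le)
      _ = (m2 / 2)⁻¹ * (‖z‖ * w₀ * m2⁻¹) * (Real.sqrt (nsq y) * Real.sqrt (nsq y)) := by ring
      _ = (m2 / 2)⁻¹ * (‖z‖ * w₀ * m2⁻¹) * nsq y := by rw [sqrt_nsq_mul_self]
  have hyx : nsq y = (((N : ℕ) : ℝ) ^ (d + 1))⁻¹ * nsq x := nsq_transpose_QmatC_mulVec x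
  have hN : (((N : ℕ) : ℝ) ^ (d + 1)) ≠ 0 := pow_ne_zero _ (Nat.cast_ne_zero.mpr (NeZero.ne N))
  rw [hcoeff]
  calc a ^ 2 * (N : ℝ) ^ (d + 1) * ‖star y ⬝ᵥ S⁻¹ *ᵥ u‖
      ≤ a ^ 2 * (N : ℝ) ^ (d + 1) * ((m2 / 2)⁻¹ * (‖z‖ * w₀ * m2⁻¹) * nsq y) := mul_le_mul_of_nonneg_left h3 (by positivity)
    _ = (2 * a ^ 2 / m2 ^ 2 * (‖z‖ * w₀)) * nsq x := by
        rw [hyx]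
        field_simp

end Fine

/-! ## §3 King's levels: the dressed covariances at complex coupling — k-uniform bound, holomorphy, Cauchy estimates -/

section King

variable (d) (a m2 : ℝ) (L : ℕ) [NeZero L] (M : Fin (d + 1) → ℕ) [∀ μ, NeZero (M μ)]

/-- **KING'S LEVEL-`k` EFFECTIVE LAPLACIAN AT COMPLEX COUPLING** `Δ^{(k)}_{z·w}` on the unit lattice `Π ℤ∕(LM_μ)` (8d's `kingLevelPot k (t·w)` with
`t ↦ z ∈ ℂ`: `N = L^k`, `a_k = aK a L k`, `c = N²`). [cite: King1986, (2.13)–(2.14) p.653, (4.5) p.670 (A = 0)] -/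
def kingLevelPotC (k : ℕ) (z : ℂ) (w : Tor (fine (L ^ k) (fine L M)) → ℝ) : Matrix (Tor (fine L M)) (Tor (fine L M)) ℂ :=
  effLaplacianPotC (L ^ k) (fine L M) (aK a L k) (((L ^ k : ℕ) : ℝ) ^ 2) m2 z w

/-- **THE DRESSED COVARIANCE AT COMPLEX COUPLING** `C^{(k)}_z = (Δ^{(k)}_{z·w} + aL⁻²Q*Q)⁻¹` (King's (4.32) with the complex-dressed level;
at real `z` it is 9c's dressed covariance, `kingCovPotC_ofReal`). [cite: King1986, (4.32) p.674 (A = 0 template)] -/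
def kingCovPotC (k : ℕ) (z : ℂ) (w : Tor (fine (L ^ k) (fine L M)) → ℝ) : Matrix (Tor (fine L M)) (Tor (fine L M)) ℂ :=
  (kingLevelPotC d a m2 L M k z w + (kingBlock a L M).map Complex.ofReal)⁻¹

/-- **THE COMPLEX COUPLING WINDOW** `r_K = min(m²∕2, γ₀m⁴∕(4a²))` (`γ₀ = gam0L`): uniform in the level, the volume and the potential. [folklore] -/
def cplxWindow (a m2 : ℝ) (L : ℕ) : ℝ := min (m2 / 2) (gam0L (d + 1) a L * m2 ^ 2 / (4 * a ^ 2))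

variable {d a m2 L M}

/-- At a real coupling the complex level is 8d's `Δ^{(k)}_{t·w}` read over ℂ. [folklore] -/
theorem kingLevelPotC_ofReal (k : ℕ) (t : ℝ) (w : Tor (fine (L ^ k) (fine L M)) → ℝ) :
    kingLevelPotC d a m2 L M k (t : ℂ) w = (kingLevelPot a m2 L M k (t • w)).map Complex.ofReal :=
  effLaplacianPotC_ofReal t w

/-- At coupling `0` the complex level is King's `Δ^{(k)}` read over ℂ. [folklore] -/
theorem kingLevelPotC_zero (k : ℕ) (w : Tor (fine (L ^ k) (fine L M)) → ℝ) :
    kingLevelPotC d a m2 L M k 0 w = (kingLevel a m2 L M k).map Complex.ofReal :=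
  effLaplacianPotC_zero w

/-- **At a real coupling the complex dressed covariance is 9c's `(Δ^{(k)}_{t·w} + aL⁻²Q*Q)⁻¹` read over ℂ.** [cite: King1986, (4.32) p.674 (A = 0 template)] -/
theorem kingCovPotC_ofReal (k : ℕ) (t : ℝ) (w : Tor (fine (L ^ k) (fine L M)) → ℝ) :
    kingCovPotC d a m2 L M k (t : ℂ) w = ((kingLevelPot a m2 L M k (t • w) + kingBlock a L M)⁻¹).map Complex.ofReal := by
  rw [kingCovPotC, kingLevelPotC_ofReal, ← map_ofReal_add, map_ofReal_inv]

omit [NeZero L] in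
/-- The window is positive. [folklore] -/
theorem cplxWindow_pos (ha : 0 < a) (hm : 0 < m2) (hL : 2 ≤ L) : 0 < cplxWindow d a m2 L :=
  lt_min (by linarith) (by have := gam0L_pos (d := d + 1) ha hL; positivity)

/-- **RE-COERCIVITY OF `Δ^{(k)}_{z·w} + aL⁻²Q*Q` AT COMPLEX COUPLING**: for `L ≥ 2`, `a, m² > 0`, `k ≥ 1`, `|w| ≤ w₀`, `‖z‖w₀ ≤ m²∕2`, the constant is
`γ₀ − (2a²∕m⁴)·‖z‖w₀` — King's (4.33) `≥ γ₀` (part 3's `uniformCoercive_kingTower`, read over ℂ) minus §2's form bound (with `a_k ≤ a`).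
[cite: King1986, (4.33) p.674 (A = 0); Balaban1985BackgroundPropagators, Thm 3.4 p.400 (template)] -/
theorem reCoercive_kingLevelPotC_add_block (ha : 0 < a) (hm : 0 < m2) (hL : 2 ≤ L) {k : ℕ} (hk : 1 ≤ k)
    {w : Tor (fine (L ^ k) (fine L M)) → ℝ} {w₀ : ℝ} (hw₀ : 0 ≤ w₀) (hw : ∀ x, |w x| ≤ w₀) {z : ℂ} (hz : ‖z‖ * w₀ ≤ m2 / 2)
    (x : Tor (fine L M) → ℂ) :
    (gam0L (d + 1) a L - 2 * a ^ 2 / m2 ^ 2 * (‖z‖ * w₀)) * nsq x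
      ≤ (star x ⬝ᵥ (kingLevelPotC d a m2 L M k z w + (kingBlock a L M).map Complex.ofReal) *ᵥ x).re := by
  have hdec : kingLevelPotC d a m2 L M k z w + (kingBlock a L M).map Complex.ofReal
      = (kingLevel a m2 L M k + kingBlock a L M).map Complex.ofReal + (kingLevelPotC d a m2 L M k z w - kingLevelPotC d a m2 L M k 0 w) := by
    rw [map_ofReal_add, ← kingLevelPotC_zero]
    abel
  rw [hdec]
  have hreal : Coercive (kingLevel a m2 L M k + kingBlock a L M) (gam0L (d + 1) a L) := by
    have h := uniformCoercive_kingTower (M := M) ha hm hL k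
    rwa [kingTower_of_one_le hk] at h
  refine reCoercive_add_of_norm_form_le (reCoercive_map_ofReal hreal) (fun x => ?_) x
  have hLr : (1 : ℝ) < L := by exact_mod_cast (by omega : 1 < L)
  have haK := aK_pos ha hLr hk
  have haKle := aK_le ha hLr hk
  have h := norm_form_effLaplacianPotC_sub_le (N := L ^ k) (U := fine L M) (a := aK a L k) (c := ((L ^ k : ℕ) : ℝ) ^ 2) (m2 := m2)
    haK.le (by positivity) hm hw₀ hw hz x
  refine h.trans (mul_le_mul_of_nonneg_right ?_ (nsq_nonneg x))
  have hsq : aK a L k ^ 2 ≤ a ^ 2 := pow_le_pow_left₀ haK.le haKle 2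
  have hs : 0 ≤ ‖z‖ * w₀ := mul_nonneg (norm_nonneg _) hw₀
  have hm2 : 0 < m2 ^ 2 := by positivity
  rw [show 2 * aK a L k ^ 2 / m2 ^ 2 * (‖z‖ * w₀) = aK a L k ^ 2 * (2 / m2 ^ 2 * (‖z‖ * w₀)) by ring,
    show 2 * a ^ 2 / m2 ^ 2 * (‖z‖ * w₀) = a ^ 2 * (2 / m2 ^ 2 * (‖z‖ * w₀)) by ring]
  exact mul_le_mul_of_nonneg_right hsq (by positivity)

/-- **ON THE WINDOW `‖z‖·w₀ ≤ r_K` THE CONSTANT IS `γ₀∕2`** (uniform in `k ≥ 1`, the volume, the potential and `z`). [cite: King1986, (4.33) p.674 (A = 0 template)] -/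
theorem reCoercive_kingLevelPotC_add_block_window (ha : 0 < a) (hm : 0 < m2) (hL : 2 ≤ L) {k : ℕ} (hk : 1 ≤ k)
    {w : Tor (fine (L ^ k) (fine L M)) → ℝ} {w₀ : ℝ} (hw₀ : 0 ≤ w₀) (hw : ∀ x, |w x| ≤ w₀) {z : ℂ} (hz : ‖z‖ * w₀ ≤ cplxWindow d a m2 L)
    (x : Tor (fine L M) → ℂ) :
    (gam0L (d + 1) a L / 2) * nsq x ≤ (star x ⬝ᵥ (kingLevelPotC d a m2 L M k z w + (kingBlock a L M).map Complex.ofReal) *ᵥ x).re := by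
  have h1 : ‖z‖ * w₀ ≤ m2 / 2 := hz.trans (min_le_left _ _)
  have h2 : ‖z‖ * w₀ ≤ gam0L (d + 1) a L * m2 ^ 2 / (4 * a ^ 2) := hz.trans (min_le_right _ _)
  refine reCoercive_mono (reCoercive_kingLevelPotC_add_block ha hm hL hk hw₀ hw h1) ?_ x
  have hm2 : 0 < m2 ^ 2 := by positivity
  have ha2 : 0 < a ^ 2 := by positivity
  have h3 : 2 * a ^ 2 / m2 ^ 2 * (‖z‖ * w₀) ≤ 2 * a ^ 2 / m2 ^ 2 * (gam0L (d + 1) a L * m2 ^ 2 / (4 * a ^ 2)) :=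
    mul_le_mul_of_nonneg_left h2 (by positivity)
  have h4 : 2 * a ^ 2 / m2 ^ 2 * (gam0L (d + 1) a L * m2 ^ 2 / (4 * a ^ 2)) = gam0L (d + 1) a L / 2 := by
    field_simp
    ring
  linarith

/-- Inside the window the matrix `Δ^{(k)}_{z·w} + aL⁻²Q*Q` has invertible determinant. [folklore] -/
theorem isUnit_det_kingLevelPotC_add_block (ha : 0 < a) (hm : 0 < m2) (hL : 2 ≤ L) {k : ℕ} (hk : 1 ≤ k)
    {w : Tor (fine (L ^ k) (fine L M)) → ℝ} {w₀ : ℝ} (hw₀ : 0 ≤ w₀) (hw : ∀ x, |w x| ≤ w₀) {z : ℂ} (hz : ‖z‖ * w₀ ≤ cplxWindow d a m2 L) :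
    IsUnit (kingLevelPotC d a m2 L M k z w + (kingBlock a L M).map Complex.ofReal).det :=
  isUnit_det_of_reCoercive (half_pos (gam0L_pos (d := d + 1) ha hL)) (reCoercive_kingLevelPotC_add_block_window ha hm hL hk hw₀ hw hz)

/-- ★★ **THE k-UNIFORM BOUND ON THE COMPLEX DISC — «the extended operators satisfy the inequalities»**: for `L ≥ 2`, `a, m² > 0`, every level
`k ≥ 1`, every volume, every potential with `|w| ≤ w₀` and every complex coupling with `‖z‖·w₀ ≤ r_K = min(m²∕2, γ₀m⁴∕(4a²))`, every entry
of the dressed covariance obeys `‖C^{(k)}_z(x,y)‖ ≤ 2∕γ₀`. [cite: Balaban1985BackgroundPropagators, Thm 3.4 p.400 (template); King1986, (4.33)–(4.34) p.674 (A = 0)] -/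
theorem kingCovPotC_apply_norm_le (ha : 0 < a) (hm : 0 < m2) (hL : 2 ≤ L) {k : ℕ} (hk : 1 ≤ k)
    {w : Tor (fine (L ^ k) (fine L M)) → ℝ} {w₀ : ℝ} (hw₀ : 0 ≤ w₀) (hw : ∀ x, |w x| ≤ w₀) {z : ℂ} (hz : ‖z‖ * w₀ ≤ cplxWindow d a m2 L)
    (x y : Tor (fine L M)) :
    ‖kingCovPotC d a m2 L M k z w x y‖ ≤ 2 / gam0L (d + 1) a L := by
  have hγ := gam0L_pos (d := d + 1) ha hL
  have h := inv_entry_norm_le_of_reCoercive (half_pos hγ) (reCoercive_kingLevelPotC_add_block_window ha hm hL hk hw₀ hw hz) x y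
  rw [kingCovPotC]
  rwa [inv_div] at h

/-- ★★ **HOLOMORPHY — [B9] THEOREM 3.4 IN KING'S MODEL**: on the window `‖z‖·w₀ ≤ r_K` every entry `z ↦ C^{(k)}_z(x,y)` of the dressed covariance is
ℂ-DIFFERENTIABLE (the entries of `Δ^{(k)}_{z·w} + aL⁻²Q*Q` are holomorphic by §1 and the matrix is invertible by (4.33) read over ℂ; Cramer's rule,
28a). [cite: Balaban1985BackgroundPropagators, Thm 3.4 p.400, (3.64)–(3.65) p.402 (template); King1986, (4.32)–(4.33) p.674 (A = 0)] -/
theorem differentiableAt_kingCovPotC_apply (ha : 0 < a) (hm : 0 < m2) (hL : 2 ≤ L) {k : ℕ} (hk : 1 ≤ k)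
    {w : Tor (fine (L ^ k) (fine L M)) → ℝ} {w₀ : ℝ} (hw₀ : 0 ≤ w₀) (hw : ∀ x, |w x| ≤ w₀) {z : ℂ} (hz : ‖z‖ * w₀ ≤ cplxWindow d a m2 L)
    (x y : Tor (fine L M)) :
    DifferentiableAt ℂ (fun z => kingCovPotC d a m2 L M k z w x y) z := by
  have hLr : (1 : ℝ) < L := by exact_mod_cast (by omega : 1 < L)
  have haK := aK_pos ha hLr hk
  have hzm : ‖z‖ * w₀ < m2 := lt_of_le_of_lt (hz.trans (min_le_left _ _)) (by linarith)
  unfold kingCovPotC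
  refine differentiableAt_inv_apply_of_entries (M := fun z => kingLevelPotC d a m2 L M k z w + (kingBlock a L M).map Complex.ofReal)
    (fun i j => ?_) (isUnit_det_kingLevelPotC_add_block ha hm hL hk hw₀ hw hz) x y
  simp only [Matrix.add_apply]
  exact (differentiableAt_effLaplacianPotC_apply haK.le (by positivity) hw hzm i j).add (differentiableAt_const _)

/-- On every closed disc inside the window the entry is `DifferentiableOn`. [folklore] -/
theorem differentiableOn_kingCovPotC_apply (ha : 0 < a) (hm : 0 < m2) (hL : 2 ≤ L) {k : ℕ} (hk : 1 ≤ k)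
    {w : Tor (fine (L ^ k) (fine L M)) → ℝ} {w₀ : ℝ} (hw₀ : 0 ≤ w₀) (hw : ∀ x, |w x| ≤ w₀) {z₀ : ℂ} {R : ℝ}
    (hzR : (‖z₀‖ + R) * w₀ ≤ cplxWindow d a m2 L) (x y : Tor (fine L M)) :
    DifferentiableOn ℂ (fun z => kingCovPotC d a m2 L M k z w x y) (Metric.closedBall z₀ R) := by
  intro z hz
  refine (differentiableAt_kingCovPotC_apply ha hm hL hk hw₀ hw ?_ x y).differentiableWithinAt
  have hzn : ‖z‖ ≤ ‖z₀‖ + R := by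
    have h1 : ‖z - z₀‖ ≤ R := mem_closedBall_iff_norm.mp hz
    calc ‖z‖ = ‖z₀ + (z - z₀)‖ := by rw [add_sub_cancel]
      _ ≤ ‖z₀‖ + ‖z - z₀‖ := norm_add_le _ _
      _ ≤ ‖z₀‖ + R := by linarith
  exact (mul_le_mul_of_nonneg_right hzn hw₀).trans hzR

/-- ★★ **CAUCHY'S ESTIMATE, ALL ORDERS, UNIFORM IN THE CUTOFF**: for `L ≥ 2`, `a, m² > 0`, `k ≥ 1`, `|w| ≤ w₀`, and every centre `z₀` and radius
`R > 0` with `(‖z₀‖ + R)·w₀ ≤ r_K`: `‖∂ⁿ_z C^{(k)}_z(x,y)|_{z = z₀}‖ ≤ n!·(2∕γ₀)∕Rⁿ` for EVERY `n` — the `n`-th order coefficient of the φ²-source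
perturbation series of the level-`k` block-spin covariance is bounded by `(2∕γ₀)R^{−n}`, uniformly in `k`, the volume and the potential (Mathlib's
`Complex.norm_iteratedDeriv_le_of_forall_mem_sphere_norm_le` on the holomorphic, `2∕γ₀`-bounded entry).
[cite: Balaban1985BackgroundPropagators, Thm 3.4 p.400 (template); King1986, (4.33)–(4.34) p.674 (A = 0)] -/
theorem norm_iteratedDeriv_kingCovPotC_le (ha : 0 < a) (hm : 0 < m2) (hL : 2 ≤ L) {k : ℕ} (hk : 1 ≤ k)
    {w : Tor (fine (L ^ k) (fine L M)) → ℝ} {w₀ : ℝ} (hw₀ : 0 ≤ w₀) (hw : ∀ x, |w x| ≤ w₀) {z₀ : ℂ} {R : ℝ} (hR : 0 < R)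
    (hzR : (‖z₀‖ + R) * w₀ ≤ cplxWindow d a m2 L) (n : ℕ) (x y : Tor (fine L M)) :
    ‖iteratedDeriv n (fun z => kingCovPotC d a m2 L M k z w x y) z₀‖ ≤ n.factorial * (2 / gam0L (d + 1) a L) / R ^ n := by
  have hdiff : DiffContOnCl ℂ (fun z => kingCovPotC d a m2 L M k z w x y) (Metric.ball z₀ R) := by
    refine DifferentiableOn.diffContOnCl ?_
    rw [closure_ball z₀ hR.ne']
    exact differentiableOn_kingCovPotC_apply ha hm hL hk hw₀ hw hzR x y
  refine Complex.norm_iteratedDeriv_le_of_forall_mem_sphere_norm_le n hR hdiff fun z hz => ?_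
  refine kingCovPotC_apply_norm_le ha hm hL hk hw₀ hw ?_ x y
  have hzn : ‖z‖ ≤ ‖z₀‖ + R := by
    have h1 : ‖z - z₀‖ = R := mem_sphere_iff_norm.mp hz
    calc ‖z‖ = ‖z₀ + (z - z₀)‖ := by rw [add_sub_cancel]
      _ ≤ ‖z₀‖ + ‖z - z₀‖ := norm_add_le _ _
      _ = ‖z₀‖ + R := by rw [h1]
  exact (mul_le_mul_of_nonneg_right hzn hw₀).trans hzR

end King

end Summit.QuantumFields.YangMills.BalabanUVNodes.N15.KingModel

end
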